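import Summits.QuantumFields.YangMills.Theorems.UnitScaleTiltProp7HcoSOfSymDiffDivRows
import Summits.QuantumFields.YangMills.Theorems.UnitScaleTiltProp7DivSliceRowHolds
import Summits.QuantumFields.YangMills.Theorems.UnitScaleTiltProp7CmapTwSJointRowXT3
import HarnessLib

/-!
# Route `UnitScaleTilt`, crux K1 «MinimiserStabilityRegPr» (stmt-QuantumFields-19200) — ARCHITECTURE (A′) ON Σ: **THE (S) ROW IS A THEOREM — `hcoS` ⇐ (N06) ∧ (β)**
# (the symmetric chain's `ℓ¹` comb-remainder row discharged by ★routeR-w3 g7 ✓`Prop7CmapTwSJointRowX.sum_norm_CmapTwS_le_jointRow_X` — F0″–F4″ of the P-A2 S-chain, ★px18 ∕ ★routeR-w6 ∕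
# ★px15 ∕ ★routeR-w3 ∕ ★px17 ∕ ★routeR-w4 — read on the `hcoS` binder)

Cell `ym3-torus` ∕ fleet seat `ym-ust-19200-p1` (gen 18, route-R E′ growth-side lead ∕ namer).  THEOREMS ONLY (0 `def`, 0 `sorry`); `--supports stmt-QuantumFields-19200`, count-neutral.
YM₃ on T³ is a ladder rung (R3), not the Clay problem; nothing here claims the stub, the crux, `hcoS`, d = 4 or the mass gap — (N06) and (β) stay DISPLAYED hypotheses (both labelled OPEN, XL).

WHY.  The (S) row of the assembler door ✓`Prop7PA2OfSymDiffDivRows.hPA2_of_symL1_diffL1_divSlice` asks, per `(L, B₁′)`, an L-only radius `eS` and constants `CS₁ CS₂ ≥ 0` with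
`Σ_ĉ‖C_S(W, iX)ĉ‖ ≤ CS₁ℓ⁻¹M + CS₂ℓ(K + DIV)` on the `hcoS` binder.  ★routeR-w3's member theorem gives exactly this bound at every `W ∈ RegPr F n K ε₀`, for every Hermitian traceless `D` with
`‖D b‖ ≤ σℓ⁻¹` and `‖iD‖_∞ < e·η`, under the windows `10⁹L²e ≤ 1`, `10¹⁴L⁹ε₀ ≤ 1`, `4·10¹¹L⁹σ ≤ 1`, with constants explicit in `(L, σ)`.  On the binder: `ε₀ := e` (from `regFibrePr`),
the chart radius `e := 2B₁′e` and the Hermitian-traceless ∕ sup data from (19), and `σ := σ_L := (4·10¹¹L⁹)⁻¹` (L-only, so `CS₁` is L-only) once `2B₁′e ≤ σ_L` — three radius conditions,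
`eS := T⁻¹`, `T := 10¹⁴L⁹ + 2·10⁹L²B₁′ + 8·10¹¹L⁹B₁′`.

WHAT IS PROVED (ns `…Theorems.Prop7HcoSOfNormG0DiffRow`): ★★ `hS_holds` — the (S) row of the assembler door, CLOSED (NO hypothesis); ★★★ `hPA2_of_diffL1` — `hPA2` ⇐ (β) alone;
★★★ `hcoS_of_normG0_of_diffL1` — `hcoS` ⇐ (N06) ∧ (β): the growth socket of record from the TWO labelled open rows (A6ᶜ coercivity at the comb slots; the comb–sym difference under `hMcomb`).
HONEST SCOPE.  Bookkeeping over landed theorems; (N06) XL and (β) L∕XL remain displayed; nothing of print asserted; rung R3, not Clay; YM gap NOT proved.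

References: T. Bałaban, CMP 102 (1985) 277–309 [Balaban1985Variational] ((19) p.281, (44)–(47) pp.285–286, (106)–(111) p.294, (141)–(142) p.299); CMP 98 (1985) 17–51 [Balaban1985Averaging]
((89)–(92) p.31, (125)–(127) p.36, Prop. 5 (157) p.41); CMP 99 (1985) 389–434 [Balaban1985BackgroundPropagators] (Thm 3.11 p.416); CMP 99 (1985) 75–102 [Balaban1985RegularSpaces] ((1.38) p.82).
-/

set_option autoImplicit false
noncomputable section

open scoped BigOperators Matrix.Norms.L2Operator Matrix Topology InnerProductSpace
open Filter NormedSpace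

namespace Summit.QuantumFields.YangMills.Theorems.Prop7HcoSOfNormG0DiffRow

open Literature.MathematicalPhysics.QuantumFieldTheory.Balaban1983to89
open Literature.MathematicalPhysics.QuantumFieldTheory.Balaban1983to89.T3ContinuumYM3Torus
open Literature.MathematicalPhysics.QuantumFieldTheory.Balaban1983to89.T3UnitLawDensityEML (ℰp)
open Literature.MathematicalPhysics.QuantumFieldTheory.Balaban1983to89.T3ConstrainedMinimiser (fibre)
open Literature.MathematicalPhysics.QuantumFieldTheory.Balaban1983to89.T3PrintedRegularMinimiser
open Literature.MathematicalPhysics.QuantumFieldTheory.Balaban1983to89.T3RegularMinimiser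
open Literature.MathematicalPhysics.QuantumFieldTheory.Balaban1983to89.T3Thm1Carrier
open T4Continuum BlockAveraging AveragingRT ExpMeanLog BlockAveragingEMLLinearised BlockAveragingEMLLinearisedBackground BlockAveragingEMLProp2
open B10Eq27TorusAxialLog (pull unitsField toUField)
open B9Eq39Adjoint (divB)
open B9TorusCalculus (torusT)
open T3SectALandauChart (emb15 eta eta_pos bgUnits In19)
open B11Eq103H1Complex (BondL2K laplaceAK)
open Summit.QuantumFields.YangMills.Theorems.Prop7SPrint (basePt RestrictedPrint AvgCondPrint IsLandauPrint)
open Summit.QuantumFields.YangMills.Theorems.Prop7TPrint (expHermField)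
open Summit.QuantumFields.YangMills.Theorems.Prop7SectET3Transport (periodsT3)
open Summit.QuantumFields.YangMills.Theorems.Prop7SectET3HilbertLetters (W₂ toL2 toL2B DL2 DstarL2)
open Summit.QuantumFields.YangMills.Theorems.Prop7SectET3WilsonHessian (DeltaEta DeltaEtaSlot)
open Summit.QuantumFields.YangMills.Theorems.Prop7SectET3CombLetters (Qkc)
open Summit.QuantumFields.YangMills.Theorems.Prop7QprimeCombL2 (RcombL2)
open Summit.QuantumFields.YangMills.Theorems.Prop7SymAvgTw (QTw CmapTw)
open Summit.QuantumFields.YangMills.Theorems.Prop7SymAvgTwSym (CmapTwS)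
open Summit.QuantumFields.YangMills.Theorems.Prop7HcoSEndToEnd (summand_window)
open Summit.QuantumFields.YangMills.Theorems.Prop7PA2OfSymDiffDivRows (hPA2_of_symL1_diffL1_divSlice)
open Summit.QuantumFields.YangMills.Theorems.Prop7HcoSOfSymDiffDivRows (hcoS_of_normG0_of_symL1_diffL1_divSlice)
open Summit.QuantumFields.YangMills.Theorems.Prop7DivSliceRowHolds (hV_holds)
open Summit.QuantumFields.YangMills.Theorems.Prop7CmapTwSJointRowX (sum_norm_CmapTwS_le_jointRow_X)

/-! ## §1 The (S) row, closed -/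

/-- ★★ **THE (S) ROW OF THE ASSEMBLER DOOR IS A THEOREM** — ★routeR-w3 g7 ✓`sum_norm_CmapTwS_le_jointRow_X` on the `hcoS` binder: `ε₀ := e`, chart radius `2B₁′e`, `σ := (4·10¹¹L⁹)⁻¹`,
Hermitian-traceless and sup data from (19); radius `eS := (10¹⁴L⁹ + 2·10⁹L²B₁′ + 8·10¹¹L⁹B₁′)⁻¹`.
[cite: Balaban1985Variational, (19) p.281, (44)-(47) pp.285-286; Balaban1985Averaging, (89)-(92) p.31, (125)-(127) p.36] -/
theorem hS_holds :
    ∀ (L : ℕ), 1 < L → ∀ (B₁' : ℝ), 0 < B₁' → ∃ eS CS₁ CS₂ : ℝ, 0 < eS ∧ 0 ≤ CS₁ ∧ 0 ≤ CS₂ ∧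
      ∀ (F : T3Family), F.L = L → ∀ (n K : ℕ) (hnK : n < K) (e : ℝ) (V : GaugeField (F.P n) 0 (Matrix.specialUnitaryGroup (Fin 2) ℂ))
        (W : GaugeField (F.P K) 0 (Matrix.specialUnitaryGroup (Fin 2) ℂ)) (X : PBond (F.P K) 0 → Matrix (Fin 2) (Fin 2) ℂ),
        0 < e → e ≤ eS → W ∈ regFibrePr F n K hnK.le e V →
        (∀ γ : ℝ → GaugeField (F.P K) 0 (Matrix.specialUnitaryGroup (Fin 2) ℂ), γ 0 = W → (∀ t, γ t ∈ fibre F ℰp n K hnK.le V) →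
          (∀ b, DifferentiableAt ℝ (fun t => ((γ t b : Matrix.specialUnitaryGroup (Fin 2) ℂ) : Matrix (Fin 2) (Fin 2) ℂ)) 0) →
            deriv (fun t => wilsonAction4 (γ t)) 0 = 0) →
        In19 F n K (2 * B₁' * e) W (expHermField X) X → AvgCondPrint F n K hnK.le V W X → IsLandauPrint F n K W X →
          ∑ ĉ : PBond (F.P n) 0, ‖CmapTwS F n K hnK.le W (fun b => Complex.I • X b) ĉ‖
              ≤ CS₁ * ((F.L : ℝ) ^ (K - n))⁻¹ * (∑ b : PBond (F.P K) 0, ‖X b‖ ^ 2) + CS₂ * ((F.L : ℝ) ^ (K - n)) * ((∑ p : Plaq (F.P K) 0, ‖((Complex.I • X ⟨p.src, p.μ⟩) + ((W ⟨p.src, p.μ⟩ : Matrix (Fin 2) (Fin 2) ℂ) * (Complex.I • X ⟨p.src.shift p.μ, p.ν⟩) * star (W ⟨p.src, p.μ⟩ : Matrix (Fin 2) (Fin 2) ℂ))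
            - (((W ⟨p.src, p.μ⟩ * W ⟨p.src.shift p.μ, p.ν⟩ * (W ⟨p.src.shift p.ν, p.μ⟩)⁻¹ : Matrix.specialUnitaryGroup (Fin 2) ℂ) : Matrix (Fin 2) (Fin 2) ℂ) * (Complex.I • X ⟨p.src.shift p.ν, p.μ⟩) * star ((W ⟨p.src, p.μ⟩ * W ⟨p.src.shift p.μ, p.ν⟩ * (W ⟨p.src.shift p.ν, p.μ⟩)⁻¹ : Matrix.specialUnitaryGroup (Fin 2) ℂ) : Matrix (Fin 2) (Fin 2) ℂ))
            - (((GaugeField.plaqHol W p : Matrix.specialUnitaryGroup (Fin 2) ℂ) : Matrix (Fin 2) (Fin 2) ℂ) * (Complex.I • X ⟨p.src, p.ν⟩) * star ((GaugeField.plaqHol W p : Matrix.specialUnitaryGroup (Fin 2) ℂ) : Matrix (Fin 2) (Fin 2) ℂ)))‖ ^ 2) + (∑ x : Site (F.P K) 0, ∑ j : Fin 2, ∑ k : Fin 2,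
              ‖(divB (torusT (F.P K) 0) (fun κ z => unitsField (toUField W) ⟨z, κ⟩) (fun κ z => Complex.I • X ⟨z, κ⟩) x) j k‖ ^ 2)) := by
  intro L hL B₁' hB₁'
  have hL0 : (0 : ℝ) < (L : ℝ) := by exact_mod_cast (show 0 < L by omega)
  obtain ⟨T, hT_def⟩ : ∃ T : ℝ, T = 100000000000000 * (L : ℝ) ^ 9 + 10 ^ 9 * (L : ℝ) ^ 2 * (2 * B₁') + 400000000000 * (L : ℝ) ^ 9 * (2 * B₁') := ⟨_, rfl⟩
  have t1 : (0 : ℝ) ≤ 100000000000000 * (L : ℝ) ^ 9 := by positivity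
  have t2 : (0 : ℝ) ≤ 10 ^ 9 * (L : ℝ) ^ 2 * (2 * B₁') := by positivity
  have t3 : (0 : ℝ) ≤ 400000000000 * (L : ℝ) ^ 9 * (2 * B₁') := by positivity
  have hTpos : 0 < T := by rw [hT_def]; positivity
  refine ⟨T⁻¹, (10 ^ 9 * (L : ℝ) ^ 4 * (2 * (L : ℝ) * (4 * (21 + 10080 * (L : ℝ) ^ 3)) + 2 / (L : ℝ) * ((4 * (3 + 720 * (L : ℝ) ^ 2) * (28800 * (L : ℝ) ^ 4)) * (384 + 60 * ((400000000000 * (L : ℝ) ^ 9)⁻¹) ^ 2) + 4 * (3 + 720 * (L : ℝ) ^ 2) * (600000 * (L : ℝ) ^ 4)))),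
    (10 ^ 9 * (L : ℝ) ^ 4 * (2 / (L : ℝ) * (8 * (4 * (3 + 720 * (L : ℝ) ^ 2) * (28800 * (L : ℝ) ^ 4))))), inv_pos.mpr hTpos, by positivity, by positivity, ?_⟩
  intro F hF n K hnK e V W X he heε hWreg _hEL h19 _h20 _h21
  have hTe : T * e ≤ 1 := by
    calc T * e ≤ T * T⁻¹ := mul_le_mul_of_nonneg_left heε hTpos.le
      _ = 1 := mul_inv_cancel₀ hTpos.ne'
  have w1 : 100000000000000 * (L : ℝ) ^ 9 * e ≤ 1 := summand_window (by rw [hT_def]; linarith) he.le hTe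
  have w2 : 10 ^ 9 * (L : ℝ) ^ 2 * (2 * B₁') * e ≤ 1 := summand_window (by rw [hT_def]; linarith) he.le hTe
  have w3 : 400000000000 * (L : ℝ) ^ 9 * (2 * B₁') * e ≤ 1 := summand_window (by rw [hT_def]; linarith) he.le hTe
  subst hF
  obtain ⟨-, hreg⟩ := (mem_regFibrePr_iff F).mp hWreg
  have hη : eta F n K = ((F.L : ℝ) ^ (K - n))⁻¹ := by rw [eta, inv_pow]
  have hηpos := eta_pos F n K
  have h2B : 0 < 2 * B₁' * e := by positivity
  have hc0 : (0 : ℝ) < 400000000000 * (F.L : ℝ) ^ 9 := by positivity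
  -- the member theorem's windows and data on the binder
  have hWe : 10 ^ 9 * (F.L : ℝ) ^ 2 * (2 * B₁' * e) ≤ 1 := by
    calc 10 ^ 9 * (F.L : ℝ) ^ 2 * (2 * B₁' * e) = 10 ^ 9 * (F.L : ℝ) ^ 2 * (2 * B₁') * e := by ring
      _ ≤ 1 := w2
  have hσ0 : (0 : ℝ) ≤ (400000000000 * (F.L : ℝ) ^ 9)⁻¹ := by positivity
  have hσL : 400000000000 * (F.L : ℝ) ^ 9 * (400000000000 * (F.L : ℝ) ^ 9)⁻¹ ≤ 1 := by
    rw [mul_inv_cancel₀ hc0.ne']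
  have hD : ∀ b : PBond (F.P K) 0, (X b).IsHermitian ∧ Matrix.trace (X b) = 0 := h19.1
  have hsmallσ : 2 * B₁' * e ≤ (400000000000 * (F.L : ℝ) ^ 9)⁻¹ := by
    have hrew : 2 * B₁' * e = (400000000000 * (F.L : ℝ) ^ 9)⁻¹ * (400000000000 * (F.L : ℝ) ^ 9 * (2 * B₁') * e) := by
      field_simp [hc0.ne']
    rw [hrew]
    exact mul_le_of_le_one_right hσ0 w3
  have hs : ∀ b : PBond (F.P K) 0, ‖X b‖ ≤ (400000000000 * (F.L : ℝ) ^ 9)⁻¹ * ((F.L : ℝ) ^ (K - n))⁻¹ := by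
    intro b
    have hb := (h19.2.2.1 b).le
    rw [hη] at hb
    exact hb.trans (mul_le_mul_of_nonneg_right hsmallσ (by positivity))
  have hXr : ‖(fun b : PBond (F.P K) 0 => Complex.I • X b)‖ < (2 * B₁' * e) * eta F n K := by
    rw [pi_norm_lt_iff (by positivity)]
    intro b
    rw [norm_smul, Complex.norm_I, one_mul]
    exact h19.2.2.1 b
  exact sum_norm_CmapTwS_le_jointRow_X F hnK.le h2B hWe w1 hσ0 hσL W hreg X hD hs hXr

/-! ## §2 `hPA2` and `hcoS` from (β) [and (N06)] alone -/

/-- ★★★ **THE P-A2 BINDER FROM THE (β) ROW ALONE** — ✓`hPA2_of_symL1_diffL1_divSlice` with `hS := hS_holds`, `hV := hV_holds`.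
[cite: Balaban1985Variational, (44)-(47) pp.285-286, (106)-(111) p.294] -/
theorem hPA2_of_diffL1
    (hD : ∀ (L : ℕ), 1 < L → ∀ (B₁' : ℝ), 0 < B₁' → ∃ eD CD₁ CD₂ : ℝ, 0 < eD ∧ 0 ≤ CD₁ ∧ 0 ≤ CD₂ ∧
      ∀ (F : T3Family), F.L = L → ∀ (n K : ℕ) (hnK : n < K) (e : ℝ) (V : GaugeField (F.P n) 0 (Matrix.specialUnitaryGroup (Fin 2) ℂ))
        (W : GaugeField (F.P K) 0 (Matrix.specialUnitaryGroup (Fin 2) ℂ)) (X : PBond (F.P K) 0 → Matrix (Fin 2) (Fin 2) ℂ),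
        0 < e → e ≤ eD → W ∈ regFibrePr F n K hnK.le e V →
        (∀ γ : ℝ → GaugeField (F.P K) 0 (Matrix.specialUnitaryGroup (Fin 2) ℂ), γ 0 = W → (∀ t, γ t ∈ fibre F ℰp n K hnK.le V) →
          (∀ b, DifferentiableAt ℝ (fun t => ((γ t b : Matrix.specialUnitaryGroup (Fin 2) ℂ) : Matrix (Fin 2) (Fin 2) ℂ)) 0) →
            deriv (fun t => wilsonAction4 (γ t)) 0 = 0) →
        In19 F n K (2 * B₁' * e) W (expHermField X) X → AvgCondPrint F n K hnK.le V W X → IsLandauPrint F n K W X →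
          ∑ ĉ : PBond (F.P n) 0, ‖CmapTw F n K hnK.le W (fun b => Complex.I • X b) ĉ - CmapTwS F n K hnK.le W (fun b => Complex.I • X b) ĉ‖
              ≤ CD₁ * ((F.L : ℝ) ^ (K - n))⁻¹ * (∑ b : PBond (F.P K) 0, ‖X b‖ ^ 2) + CD₂ * ((F.L : ℝ) ^ (K - n)) * ((∑ p : Plaq (F.P K) 0, ‖((Complex.I • X ⟨p.src, p.μ⟩) + ((W ⟨p.src, p.μ⟩ : Matrix (Fin 2) (Fin 2) ℂ) * (Complex.I • X ⟨p.src.shift p.μ, p.ν⟩) * star (W ⟨p.src, p.μ⟩ : Matrix (Fin 2) (Fin 2) ℂ))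
            - (((W ⟨p.src, p.μ⟩ * W ⟨p.src.shift p.μ, p.ν⟩ * (W ⟨p.src.shift p.ν, p.μ⟩)⁻¹ : Matrix.specialUnitaryGroup (Fin 2) ℂ) : Matrix (Fin 2) (Fin 2) ℂ) * (Complex.I • X ⟨p.src.shift p.ν, p.μ⟩) * star ((W ⟨p.src, p.μ⟩ * W ⟨p.src.shift p.μ, p.ν⟩ * (W ⟨p.src.shift p.ν, p.μ⟩)⁻¹ : Matrix.specialUnitaryGroup (Fin 2) ℂ) : Matrix (Fin 2) (Fin 2) ℂ))
            - (((GaugeField.plaqHol W p : Matrix.specialUnitaryGroup (Fin 2) ℂ) : Matrix (Fin 2) (Fin 2) ℂ) * (Complex.I • X ⟨p.src, p.ν⟩) * star ((GaugeField.plaqHol W p : Matrix.specialUnitaryGroup (Fin 2) ℂ) : Matrix (Fin 2) (Fin 2) ℂ)))‖ ^ 2) + (∑ x : Site (F.P K) 0, ∑ j : Fin 2, ∑ k : Fin 2,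
              ‖(divB (torusT (F.P K) 0) (fun κ z => unitsField (toUField W) ⟨z, κ⟩) (fun κ z => Complex.I • X ⟨z, κ⟩) x) j k‖ ^ 2))) :
    ∀ (L : ℕ), 1 < L → ∀ (B₁' : ℝ), 0 < B₁' → ∃ eJ C₁ C₂ ζ δ₁ : ℝ, 0 < eJ ∧ 0 ≤ C₁ ∧ 0 ≤ C₂ ∧ 0 ≤ ζ ∧ 0 ≤ δ₁ ∧
      ∀ (F : T3Family), F.L = L → ∀ (n K : ℕ) (hnK : n < K) (e : ℝ) (V : GaugeField (F.P n) 0 (Matrix.specialUnitaryGroup (Fin 2) ℂ))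
        (W : GaugeField (F.P K) 0 (Matrix.specialUnitaryGroup (Fin 2) ℂ)) (X : PBond (F.P K) 0 → Matrix (Fin 2) (Fin 2) ℂ),
        0 < e → e ≤ eJ → W ∈ regFibrePr F n K hnK.le e V →
        (∀ γ : ℝ → GaugeField (F.P K) 0 (Matrix.specialUnitaryGroup (Fin 2) ℂ), γ 0 = W → (∀ t, γ t ∈ fibre F ℰp n K hnK.le V) →
          (∀ b, DifferentiableAt ℝ (fun t => ((γ t b : Matrix.specialUnitaryGroup (Fin 2) ℂ) : Matrix (Fin 2) (Fin 2) ℂ)) 0) →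
            deriv (fun t => wilsonAction4 (γ t)) 0 = 0) →
        In19 F n K (2 * B₁' * e) W (expHermField X) X → AvgCondPrint F n K hnK.le V W X → IsLandauPrint F n K W X →
          ∃ dv : ℝ, ∑ ĉ : PBond (F.P n) 0, ‖CmapTw F n K hnK.le W (fun b => Complex.I • X b) ĉ‖
              ≤ C₁ * ((F.L : ℝ) ^ (K - n))⁻¹ * (∑ b : PBond (F.P K) 0, ‖X b‖ ^ 2) + C₂ * ((F.L : ℝ) ^ (K - n)) * ((∑ p : Plaq (F.P K) 0, ‖((Complex.I • X ⟨p.src, p.μ⟩) + ((W ⟨p.src, p.μ⟩ : Matrix (Fin 2) (Fin 2) ℂ) * (Complex.I • X ⟨p.src.shift p.μ, p.ν⟩) * star (W ⟨p.src, p.μ⟩ : Matrix (Fin 2) (Fin 2) ℂ))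
            - (((W ⟨p.src, p.μ⟩ * W ⟨p.src.shift p.μ, p.ν⟩ * (W ⟨p.src.shift p.ν, p.μ⟩)⁻¹ : Matrix.specialUnitaryGroup (Fin 2) ℂ) : Matrix (Fin 2) (Fin 2) ℂ) * (Complex.I • X ⟨p.src.shift p.ν, p.μ⟩) * star ((W ⟨p.src, p.μ⟩ * W ⟨p.src.shift p.μ, p.ν⟩ * (W ⟨p.src.shift p.ν, p.μ⟩)⁻¹ : Matrix.specialUnitaryGroup (Fin 2) ℂ) : Matrix (Fin 2) (Fin 2) ℂ))
            - (((GaugeField.plaqHol W p : Matrix.specialUnitaryGroup (Fin 2) ℂ) : Matrix (Fin 2) (Fin 2) ℂ) * (Complex.I • X ⟨p.src, p.ν⟩) * star ((GaugeField.plaqHol W p : Matrix.specialUnitaryGroup (Fin 2) ℂ) : Matrix (Fin 2) (Fin 2) ℂ)))‖ ^ 2) + dv) ∧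
            dv ≤ ζ * (∑ p : Plaq (F.P K) 0, ‖((Complex.I • X ⟨p.src, p.μ⟩) + ((W ⟨p.src, p.μ⟩ : Matrix (Fin 2) (Fin 2) ℂ) * (Complex.I • X ⟨p.src.shift p.μ, p.ν⟩) * star (W ⟨p.src, p.μ⟩ : Matrix (Fin 2) (Fin 2) ℂ))
            - (((W ⟨p.src, p.μ⟩ * W ⟨p.src.shift p.μ, p.ν⟩ * (W ⟨p.src.shift p.ν, p.μ⟩)⁻¹ : Matrix.specialUnitaryGroup (Fin 2) ℂ) : Matrix (Fin 2) (Fin 2) ℂ) * (Complex.I • X ⟨p.src.shift p.ν, p.μ⟩) * star ((W ⟨p.src, p.μ⟩ * W ⟨p.src.shift p.μ, p.ν⟩ * (W ⟨p.src.shift p.ν, p.μ⟩)⁻¹ : Matrix.specialUnitaryGroup (Fin 2) ℂ) : Matrix (Fin 2) (Fin 2) ℂ))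
            - (((GaugeField.plaqHol W p : Matrix.specialUnitaryGroup (Fin 2) ℂ) : Matrix (Fin 2) (Fin 2) ℂ) * (Complex.I • X ⟨p.src, p.ν⟩) * star ((GaugeField.plaqHol W p : Matrix.specialUnitaryGroup (Fin 2) ℂ) : Matrix (Fin 2) (Fin 2) ℂ)))‖ ^ 2) + δ₁ * (((F.L : ℝ) ^ (K - n)) ^ 2)⁻¹ * (∑ b : PBond (F.P K) 0, ‖X b‖ ^ 2) :=
  hPA2_of_symL1_diffL1_divSlice hS_holds hD hV_holds

section E2E

variable (c₀ cB a₀ : ℕ → ℝ) [hc₀ : ∀ L : ℕ, Fact (0 < c₀ L)] [hcB : ∀ L : ℕ, Fact (0 < cB L)]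

/-- ★★★ **THE GROWTH SOCKET `hcoS` FROM THE TWO LABELLED OPEN ROWS (N06) ∧ (β)** — ✓`hcoS_of_normG0_of_symL1_diffL1_divSlice` with `hS := hS_holds`, `hV := hV_holds`.
CONCLUSION: `hcoS` VERBATIM. [cite: Balaban1985Variational, (141)-(142) p.299, (44)-(47) pp.285-286; Balaban1985BackgroundPropagators, Thm 3.11 p.416] -/
theorem hcoS_of_normG0_of_diffL1 (ha₀ : ∀ L : ℕ, 0 ≤ a₀ L)
    (hN06 : ∀ (L : ℕ), 1 < L → ∃ B₀ eN : ℝ, 0 < B₀ ∧ 0 < eN ∧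
      ∀ (F : T3Family), F.L = L → ∀ (n K : ℕ) (hnK : n < K) (e : ℝ) (W : GaugeField (F.P K) 0 (Matrix.specialUnitaryGroup (Fin 2) ℂ)),
        0 < e → e ≤ eN → RegPr F n K e W →
        ∃ G₀ : BondL2K ℂ 3 (periodsT3 F K) (c₀ F.L) W₂ →ₗ[ℂ] BondL2K ℂ 3 (periodsT3 F K) (c₀ F.L) W₂,
          laplaceAK (DeltaEtaSlot F n K (c₀ F.L) W) (DL2 F n K (c₀ F.L) W) (RcombL2 F n K (c₀ F.L) W) (DstarL2 F n K (c₀ F.L) W)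
              (Qkc F n K hnK.le (c₀ F.L) (cB F.L) W) (LinearMap.adjoint (Qkc F n K hnK.le (c₀ F.L) (cB F.L) W))
              (((a₀ F.L * (c₀ F.L / cB F.L) * ((F.L : ℝ) ^ (K - n)) ^ 3 : ℝ) : ℂ)) ∘ₗ G₀ = LinearMap.id ∧
          ∀ f, ‖G₀ f‖ ≤ B₀ * ‖f‖)
    (hD : ∀ (L : ℕ), 1 < L → ∀ (B₁' : ℝ), 0 < B₁' → ∃ eD CD₁ CD₂ : ℝ, 0 < eD ∧ 0 ≤ CD₁ ∧ 0 ≤ CD₂ ∧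
      ∀ (F : T3Family), F.L = L → ∀ (n K : ℕ) (hnK : n < K) (e : ℝ) (V : GaugeField (F.P n) 0 (Matrix.specialUnitaryGroup (Fin 2) ℂ))
        (W : GaugeField (F.P K) 0 (Matrix.specialUnitaryGroup (Fin 2) ℂ)) (X : PBond (F.P K) 0 → Matrix (Fin 2) (Fin 2) ℂ),
        0 < e → e ≤ eD → W ∈ regFibrePr F n K hnK.le e V →
        (∀ γ : ℝ → GaugeField (F.P K) 0 (Matrix.specialUnitaryGroup (Fin 2) ℂ), γ 0 = W → (∀ t, γ t ∈ fibre F ℰp n K hnK.le V) →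
          (∀ b, DifferentiableAt ℝ (fun t => ((γ t b : Matrix.specialUnitaryGroup (Fin 2) ℂ) : Matrix (Fin 2) (Fin 2) ℂ)) 0) →
            deriv (fun t => wilsonAction4 (γ t)) 0 = 0) →
        In19 F n K (2 * B₁' * e) W (expHermField X) X → AvgCondPrint F n K hnK.le V W X → IsLandauPrint F n K W X →
          ∑ ĉ : PBond (F.P n) 0, ‖CmapTw F n K hnK.le W (fun b => Complex.I • X b) ĉ - CmapTwS F n K hnK.le W (fun b => Complex.I • X b) ĉ‖
              ≤ CD₁ * ((F.L : ℝ) ^ (K - n))⁻¹ * (∑ b : PBond (F.P K) 0, ‖X b‖ ^ 2) + CD₂ * ((F.L : ℝ) ^ (K - n)) * ((∑ p : Plaq (F.P K) 0, ‖((Complex.I • X ⟨p.src, p.μ⟩) + ((W ⟨p.src, p.μ⟩ : Matrix (Fin 2) (Fin 2) ℂ) * (Complex.I • X ⟨p.src.shift p.μ, p.ν⟩) * star (W ⟨p.src, p.μ⟩ : Matrix (Fin 2) (Fin 2) ℂ))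
            - (((W ⟨p.src, p.μ⟩ * W ⟨p.src.shift p.μ, p.ν⟩ * (W ⟨p.src.shift p.ν, p.μ⟩)⁻¹ : Matrix.specialUnitaryGroup (Fin 2) ℂ) : Matrix (Fin 2) (Fin 2) ℂ) * (Complex.I • X ⟨p.src.shift p.ν, p.μ⟩) * star ((W ⟨p.src, p.μ⟩ * W ⟨p.src.shift p.μ, p.ν⟩ * (W ⟨p.src.shift p.ν, p.μ⟩)⁻¹ : Matrix.specialUnitaryGroup (Fin 2) ℂ) : Matrix (Fin 2) (Fin 2) ℂ))
            - (((GaugeField.plaqHol W p : Matrix.specialUnitaryGroup (Fin 2) ℂ) : Matrix (Fin 2) (Fin 2) ℂ) * (Complex.I • X ⟨p.src, p.ν⟩) * star ((GaugeField.plaqHol W p : Matrix.specialUnitaryGroup (Fin 2) ℂ) : Matrix (Fin 2) (Fin 2) ℂ)))‖ ^ 2) + (∑ x : Site (F.P K) 0, ∑ j : Fin 2, ∑ k : Fin 2,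
              ‖(divB (torusT (F.P K) 0) (fun κ z => unitsField (toUField W) ⟨z, κ⟩) (fun κ z => Complex.I • X ⟨z, κ⟩) x) j k‖ ^ 2))) :
    ∀ (L : ℕ), 1 < L → ∀ (B₁' : ℝ), 0 < B₁' → ∃ e₇ : ℝ, 0 < e₇ ∧
      ∀ (F : T3Family), F.L = L → ∀ (n K : ℕ) (hnK : n < K) (e : ℝ) (V : GaugeField (F.P n) 0 (Matrix.specialUnitaryGroup (Fin 2) ℂ))
        (W : GaugeField (F.P K) 0 (Matrix.specialUnitaryGroup (Fin 2) ℂ)) (X : PBond (F.P K) 0 → Matrix (Fin 2) (Fin 2) ℂ),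
        0 < e → e ≤ e₇ → W ∈ regFibrePr F n K hnK.le e V →
        (∀ γ : ℝ → GaugeField (F.P K) 0 (Matrix.specialUnitaryGroup (Fin 2) ℂ), γ 0 = W → (∀ t, γ t ∈ fibre F ℰp n K hnK.le V) →
          (∀ b, DifferentiableAt ℝ (fun t => ((γ t b : Matrix.specialUnitaryGroup (Fin 2) ℂ) : Matrix (Fin 2) (Fin 2) ℂ)) 0) →
            deriv (fun t => wilsonAction4 (γ t)) 0 = 0) →
        In19 F n K (2 * B₁' * e) W (expHermField X) X → AvgCondPrint F n K hnK.le V W X → IsLandauPrint F n K W X →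
          wilsonAction4 W ≤ wilsonAction4 (emb15 W (expHermField X)) := by
  exact hcoS_of_normG0_of_symL1_diffL1_divSlice c₀ cB a₀ ha₀ hN06 hS_holds hD hV_holds

end E2E

end Summit.QuantumFields.YangMills.Theorems.Prop7HcoSOfNormG0DiffRow

end
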